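import Summits.NavierStokesRegularity.NavierStokesRegularity.Theses.SelfMixingDichotomy
import Summits.NavierStokesRegularity.NavierStokesRegularity.Theorems.SelfMixingDichotomySequentialTypeIExclusionStubLerayHopfLocalEnergySolution
import Summits.NavierStokesRegularity.NavierStokesRegularity.Theorems.SelfMixingDichotomySequentialTypeIExclusionStubContinuationPastFinalTime
import Summits.NavierStokesRegularity.NavierStokesRegularity.Theorems.SelfMixingDichotomySequentialTypeIExclusionStubFinalTimeTypeISingularPoint
import Literature.Analysis.FluidPDE.PartialRegularity
import Literature.Analysis.FluidPDE.LocalEnergySolutionsOn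
import Literature.Analysis.FluidPDE.SereginSverakPressureProofs
import HarnessLib.Audit

/-!
# CLOSED TWIN of the r4 skeleton of the crux `SelfMixingDichotomy.SequentialTypeIExclusion` — line `registered`

(No `sorry`: the two OPEN stubs become hypotheses of `SequentialTypeIExclusion_of_hyps`; plus the Type-I half alone,
`bdd_of_centredTypeIBound_of_not_typeISingularityExists`. The rest of this header is the skeleton's, for context.)


(crux item `stmt-NavierStokesRegularity-1424`, rank 4, route `route-NavierStokesRegularity-SelfMixingDichotomy`;
tree path `Cruxes/SequentialTypeIExclusion/Lines/birth.lean`; birth registrar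
`planner-skel-stmt-NavierStokesRegularity-1424-0`; reshapes r1/r2 by lead 0, r3 by lead c1, **r4 by the continuation
lead `prover-line-stmt-NavierStokesRegularity-1424-c2-0`, 2026-08-17** — see "Reshape r4" below; the r1–r3 history is
kept verbatim in the tree's git history of this file and summarised at the end of this docstring.)

THE CRUX (S1, "Type-I windows"). For every `M`, every classical Leray–Hopf solution `u` (ν = 1) on
`ℝ³ × [0,T)` from a rapidly decaying datum and every `x₀`: if the local Reynolds number
`C(r) = r⁻² ∬_{Q_r(T,x₀)} |u|³` (`Literature.Analysis.FluidPDE.cknC`, backward cylinders ending at `T`) satisfies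
`C(r_k) ≤ M` along SOME sequence `r_k → 0` (liminf form), then `u` is bounded on some `(T−ρ²,T) × B_ρ(x₀)` (BDD).

## Reshape r4 (continuation lead c2, 2026-08-17) — what changed and why

r3 had isolated the Type-I half of the crux as `stub_noTypeIBlowup` = Seregin's open question "does boundedness of
`g` allow blowups?" in the unit-cylinder/backward form of the named fact
`Seregin2020_axisymmetricSingularPoint_typeII` (minus axisymmetry). That statement is NOT a registered decl of the
tree, so reading S1 as a conditional bridge required the planner to file a NEW conjecture def
(`SereginTypeIBlowupExists`, prepared by c1). r4 removes that need: the Type-I half is now LITERALLY the negation of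
the EXISTING registered conjecture decl `Literature.Analysis.FluidPDE.TypeISingularityExists`
(`PartialRegularity.lean`: a suitable weak solution on an open space–time region with a CENTRED Type-I singular
point, `sup_{0<r<r₀} (A + C + D + E)(r, z) < ∞`, `z` INTERIOR). The geometric obstruction noted by c1 — S1's point
`(T, x₀)` sits on the FINAL slice of a solution living on `[0, T)`, while `TypeISingularityExists` wants an interior
point — is removed by KNOWN mathematics, split into three provable stubs:

* `stub_lerayHopfLocalEnergySolution` [M, KNOWN; CLOSED — LANDED p157188 — Seregin 2014 App. B §B.5 / Lemarié-Rieusset 2016 §14.9; the tree's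
  `IsGlobalLerayHopf.isLocalEnergySolutionOn_of_suitable_of_eqOn` uses only `IsLerayHopfOn T`]: a classical solution
  on `[0,T)` which is Leray–Hopf on `[0,T]` is, with the gauged pressure `q = p − (p(·,0) − p̃[u](0))`
  (`SereginSverak2002.isSuitableWeakSolutionOn_gauge_of_classical`, `lintegral_slab_gauged_pressure_lt_top`), a local
  energy solution on `ℝ³ × (0, T)` with datum `u 0` (`IsLocalEnergySolutionOn T 1 (u 0) u q`).
* `stub_continuationPastFinalTime` [S; CLOSED — LANDED p156995 after the lead's Literature generalisation p156682; KNOWN — Leray 1934 /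
  Lemarié-Rieusset 2016 Thm 14.8 Step 2 / Seregin 2014 §B.5]: a local energy solution on `(0, T)` whose FINAL slice
  `v T` has finite energy extends to a local energy solution on `(0, T + 1)` agreeing with it on `[0, T]`: restart a
  global weak Leray–Hopf + local energy solution from `v T` (`exists_isGlobalLerayHopf_and_isLocalEnergySolutionOn`;
  `v T` is weakly divergence-free by `IsLocalEnergySolutionOn.integral_inner_gradient_slice_eq_zero` at `t = T`) and
  concatenate AT THE FINAL SLICE (`IsLocalEnergySolutionOn.exists_extension_of_slice_of_le`, the `t₀ ≤ T` form of the
  tree's concatenation theorem, proposal p156682 of this lead: the junction needs only the weak continuity on the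
  closed interval, the weak form and the local energy inequality AT the slice `T`, all in the class). No uniqueness.
* `stub_finalTimeTypeISingularPoint` [M/L, KNOWN; CLOSED — LANDED p157669 — Seregin 2007 / 2020 "one scaled quantity bounded ⇒ all bounded",
  in tree as `Seregin2020.scaledEnergies_bounded_of_cknC_le`]: if such a continuation `(U, P)` of `(u, q)` exists on
  `(0, T')`, `T < T'`, then a centred cubic Type-I bound `C(r; T, x₀) ≤ M'` (`0 < r < r₁`) for `u` at a point where `u`
  is NOT bounded near `(T, x₀)` makes `(T, x₀)` a centred Type-I singular point of `(U, P)` on the open slab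
  `(0, T') × ℝ³` (`IsTypeISingularPoint`): `U = u`, `P = q` below `T`; `D(r₀) < ∞` from `q ∈ L^{3/2}` of the slab,
  `A, E` at one scale from the energy class, whence `Aₑₛₛ + E + C + D ≤ K` on `(0, r₀/2]`; the genuine `sup_t` in the
  accepted `cknA` equals the `esssup` below `T` by continuity of `u`; `E` is computed with the weak gradient of the
  continuation (any weak gradient works in Seregin's bound); not regular at `(T,x₀)` because an essential bound on a
  centred cylinder is a pointwise bound on its lower half by continuity (`SereginSverak2002.norm_le_of_ae_restrict_of_continuousOn`).
* `stub_noTypeISingularity` [XL, OPEN — the REGISTERED conjecture decl negated]: `¬ TypeISingularityExists`, i.e. no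
  suitable weak solution has a centred Type-I singular interior point. This is Type-I exclusion in Seregin's sense
  ("whether the boundedness of `g` allows blowups or not … is still open", Seregin arXiv:2304.04045 p. 3; 2402.13229
  p. 2; 2507.08733), of which the crux's sup-form is an instance (`TypeISingularityExists` is a registered OPEN
  existence question; its negation is the open Type-I exclusion statement every line of S1 contains). A planner can
  now read S1 as `--conditional-on TypeISingularityExists` WITHOUT filing anything new.
* `stub_windowsForceTypeI` [L, OPEN — UNCHANGED since birth; no literature]: Type-I windows at arbitrarily small
  scales force a centred cubic Type-I bound (no scale-intermittency). Provable corners landed: log-dense windows and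
  `M ≤ 0` (`…Theorems.SequentialTypeIExclusion.Registered.windowsForceTypeI_logDense/_logDenseSeq/_nonpos`, p156105).

`SequentialTypeIExclusion_of : SequentialTypeIExclusion` is the ONLY theorem of this file concluding the crux
(conclusion = the crux BY NAME, no `Prop` hypotheses, `sorry` only inside the two OPEN stubs `stub_windowsForceTypeI`, `stub_noTypeISingularity`; the three KNOWN stubs are landed and used by name):
windows ⇒ (stub_windowsForceTypeI) centred Type-I bound; if `u` is bounded near `(T,x₀)` we are done; otherwise
(stub_lerayHopfLocalEnergySolution, stub_continuationPastFinalTime) continue `u` past `T` and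
(stub_finalTimeTypeISingularPoint) exhibit a centred Type-I singular point, contradicting stub_noTypeISingularity.
Hence, kernel-checked: **S1 ⇐ no-scale-intermittency ∧ ¬TypeISingularityExists**, with ALL glue LANDED (p157188, p156995, p157669; Literature p156682).

What r4 drops from the skeleton (all LANDED, kept in the tree as `--supports` helpers of the item, and still a valid
alternative composition): r1's `stub_typeIWindowEpsilonRegularity` (p147358), r2's `stub_centredTypeITangentFlow`
(p149197) and the r3 glue `noCentredTypeITangentFlow_of_noTypeIBlowup` / `noTypeIBlowup_of_noCentredTypeITangentFlow`
(p153495: over the tree, "no centred Type-I tangent flow" ⇔ "no Type I blowup in Seregin's unit-cylinder sense").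
r3's open `stub_noTypeIBlowup` (unit-cylinder form) and r4's `stub_noTypeISingularity` (interior form) are two
phrasings of the same open problem; r4's is the tree's registered one.

## History (r1–r3, leads 0 and c1, 2026-08-17) — one line each
r1: birth stub 1 (velocity-only one-scale ε-regularity, Wolf) not derivable from the tree (no local pressure
projection) → replaced by ε-regularity under a Type-I bound, landed p147358. r2: birth stub 3 (Type-I bound ⇒ deep
windows) cut into tangent-flow extraction (landed p149197) + tangent-flow rigidity (open). r3: rigidity rephrased as
Seregin's "no Type I blowup" (open, = named fact minus axisymmetry), equivalence glue landed p153495.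
-/

noncomputable section

open Set MeasureTheory Filter Topology Metric
open scoped ENNReal NNReal

namespace Summit.NavierStokesRegularity.NavierStokesRegularity.Cruxes.SequentialTypeIExclusion.BirthClosed

set_option linter.unusedVariables false
set_option linter.dupNamespace false

/-- **stub 3 (r4) — `stub_lerayHopfLocalEnergySolution` (M; CLOSED: LANDED p157188 as `…Theorems.SequentialTypeIExclusion.Registered.stub_lerayHopfLocalEnergySolution`; KNOWN: Leray–Hopf solutions which are suitable on the
strip are local energy solutions — Seregin 2014, App. B Def. B.1 & §B.5; Lemarié-Rieusset 2016, §14.9; the tree's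
`IsGlobalLerayHopf.isLocalEnergySolutionOn_of_suitable_of_eqOn` uses of the global class only its restriction
`IsLerayHopfOn T`).** A classical solution of Navier–Stokes (ν = 1, no force) on `ℝ³ × [0, T)` which is a Leray–Hopf
weak solution on `[0, T]` is, together with the gauged pressure `q(t, x) = p(t, x) − (p(t, 0) − p̃[u(t)](0))`
(`SereginSverak2002.isSuitableWeakSolutionOn_gauge_of_classical`: suitable on the open strip;
`SereginSverak2002.lintegral_slab_gauged_pressure_lt_top`: `q ∈ L^{3/2}((0,T) × ℝ³)`), a local energy solution on
`ℝ³ × (0, T)` with datum `u 0` in the sense of Seregin 2014, Def. B.1 (`IsLocalEnergySolutionOn`). -/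
theorem stub_lerayHopfLocalEnergySolution :
    ∀ T : ℝ, 0 < T →
      ∀ (u : ℝ → EuclideanSpace ℝ (Fin 3) → EuclideanSpace ℝ (Fin 3))
        (p : ℝ → EuclideanSpace ℝ (Fin 3) → ℝ),
        Literature.Analysis.FluidPDE.IsClassicalNSSolutionOn (Set.Ico 0 T) 1 0 u p →
        Literature.Analysis.FluidPDE.IsLerayHopfOn T 1 0 (u 0) u →
        Literature.Analysis.FluidPDE.IsLocalEnergySolutionOn T 1 (u 0) u
          (fun t x => p t x - (p t 0 - Literature.Analysis.FluidPDE.normalisedPressure (u t) 0)) :=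
  Summit.NavierStokesRegularity.NavierStokesRegularity.Theorems.SequentialTypeIExclusion.Registered.stub_lerayHopfLocalEnergySolution

/-- **stub 4 (r4) — `stub_continuationPastFinalTime` (S; CLOSED: LANDED p156995 as `…Registered.stub_continuationPastFinalTime`,
using the `t₀ ≤ T` concatenation theorem p156682; KNOWN: Leray 1934 weak continuation; Lemarié-Rieusset 2016 Thm. 14.8 proof Step 2; Seregin 2014 App. B §B.5).**
A local energy solution `(v, π)` on `ℝ³ × (0, T)` (ν = 1) whose final slice `v T` has finite energy extends to a local
energy solution `(U, P)` on `ℝ³ × (0, T + 1)` with the same datum which agrees with `(v, π)` on `[0, T]`: restart a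
global weak Leray–Hopf + local energy solution from the weakly divergence-free final slice
(`exists_isGlobalLerayHopf_and_isLocalEnergySolutionOn`, `IsLocalEnergySolutionOn.integral_inner_gradient_slice_eq_zero`
at `t = T`) and concatenate at the final slice (`IsLocalEnergySolutionOn.exists_extension_of_slice_of_le`). -/
theorem stub_continuationPastFinalTime :
    ∀ T : ℝ, 0 < T →
      ∀ (v₀ : EuclideanSpace ℝ (Fin 3) → EuclideanSpace ℝ (Fin 3))
        (v : ℝ → EuclideanSpace ℝ (Fin 3) → EuclideanSpace ℝ (Fin 3))
        (π : ℝ → EuclideanSpace ℝ (Fin 3) → ℝ),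
        Literature.Analysis.FluidPDE.IsLocalEnergySolutionOn T 1 v₀ v π →
        MeasureTheory.MemLp (v T) 2 MeasureTheory.volume →
        ∃ (U : ℝ → EuclideanSpace ℝ (Fin 3) → EuclideanSpace ℝ (Fin 3))
          (P : ℝ → EuclideanSpace ℝ (Fin 3) → ℝ),
          Literature.Analysis.FluidPDE.IsLocalEnergySolutionOn (T + 1) 1 v₀ U P ∧
          ∀ t ∈ Set.Icc 0 T, U t = v t ∧ P t = π t :=
  Summit.NavierStokesRegularity.NavierStokesRegularity.Theorems.SequentialTypeIExclusion.Registered.stub_continuationPastFinalTime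

/-- **stub 5 (r4) — `stub_finalTimeTypeISingularPoint` (M/L; CLOSED: LANDED p157669 as `…Registered.stub_finalTimeTypeISingularPoint`, 312 lines; KNOWN: "one scaled energy quantity bounded ⇒ all
bounded", Seregin 2007 / Seregin 2020 §2, in tree as `Seregin2020.scaledEnergies_bounded_of_cknC_le`; regular points
are points of essential boundedness, CKN 1982 §6).** Let `u` be a classical solution on `ℝ³ × [0,T)` (ν = 1), Leray–Hopf
on `[0,T]`, and let `(U, P)` be a local energy solution on `ℝ³ × (0, T')`, `T < T'`, agreeing on `[0, T]` with `u` and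
its gauged pressure `q`. If `C(r; T, x₀) ≤ M'` for `0 < r < r₁` (centred cubic Type-I bound for `u`) and `u` is NOT
bounded on any `(T − ρ², T) × B_ρ(x₀)`, then `(T, x₀)` is a centred Type-I singular point of `(U, P)` on the open slab
`(0, T') × ℝ³` (`IsTypeISingularPoint`: suitable there; `(T,x₀)` interior and not regular — an essential bound on a
centred cylinder bounds `u` pointwise on its lower half by continuity; a weak spatial gradient `G` of `U` on the slab;
and `sup_{0<r<r₀} (A + C + D + E)(r; T, x₀) < ∞` — backward cylinders, where `U = u`, `P = q`: `D(r₀) < ∞` from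
`q ∈ L^{3/2}((0,T) × ℝ³)`, Seregin's bound gives `Aₑₛₛ + E + C + D ≤ K` on `(0, r₀/2]`, and the accepted `sup_t`
quantity `cknA` equals `cknAEss` below `T` because `t ↦ ∫_{B_r} |u(t)|²` is continuous on `(T − r², T)`). -/
theorem stub_finalTimeTypeISingularPoint :
    ∀ M' T T' : ℝ, 0 < T → T < T' →
      ∀ (u : ℝ → EuclideanSpace ℝ (Fin 3) → EuclideanSpace ℝ (Fin 3))
        (p : ℝ → EuclideanSpace ℝ (Fin 3) → ℝ)
        (U : ℝ → EuclideanSpace ℝ (Fin 3) → EuclideanSpace ℝ (Fin 3))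
        (P : ℝ → EuclideanSpace ℝ (Fin 3) → ℝ),
        Literature.Analysis.FluidPDE.IsClassicalNSSolutionOn (Set.Ico 0 T) 1 0 u p →
        Literature.Analysis.FluidPDE.IsLerayHopfOn T 1 0 (u 0) u →
        Literature.Analysis.FluidPDE.IsLocalEnergySolutionOn T' 1 (u 0) U P →
        (∀ t ∈ Set.Icc 0 T, U t = u t ∧
          P t = fun x => p t x - (p t 0 - Literature.Analysis.FluidPDE.normalisedPressure (u t) 0)) →
        ∀ x₀ : EuclideanSpace ℝ (Fin 3),
          (∃ r₁ : ℝ, 0 < r₁ ∧ ∀ r ∈ Set.Ioo 0 r₁,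
            Literature.Analysis.FluidPDE.cknC r ((T, x₀) : ℝ × EuclideanSpace ℝ (Fin 3)) u ≤ ENNReal.ofReal M') →
          (¬ ∃ ρ : ℝ, 0 < ρ ∧ ∃ M : ℝ, ∀ t ∈ Set.Ioo (T - ρ ^ 2) T, ∀ x ∈ Metric.ball x₀ ρ, ‖u t x‖ ≤ M) →
          Literature.Analysis.FluidPDE.IsTypeISingularPoint
            (Literature.Analysis.FluidPDE.slab (EuclideanSpace ℝ (Fin 3)) (Set.Ioo 0 T') isOpen_Ioo)
            U P ((T, x₀) : ℝ × EuclideanSpace ℝ (Fin 3)) :=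
  Summit.NavierStokesRegularity.NavierStokesRegularity.Theorems.SequentialTypeIExclusion.Registered.stub_finalTimeTypeISingularPoint

/-- **Closed twin of the r4 composition (no `sorry`): the crux from its two OPEN stubs taken as hypotheses.**
`S1 ⇐ (no scale-intermittency: Type-I windows at arbitrarily small scales force a centred cubic Type-I bound) ∧
¬TypeISingularityExists`, everything else being LANDED (p157188, p156995, p157669; Literature p156682). This is the
kernel-checkable form of the statement "the line reduces the crux to no-scale-intermittency plus centred Type-I
exclusion in the tree's registered form"; a planner can file S1's Type-I half `--conditional-on TypeISingularityExists`. -/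
theorem SequentialTypeIExclusion_of_hyps
    (hwin : ∀ M : ℝ, ∀ T : ℝ, 0 < T →
      ∀ (u : ℝ → EuclideanSpace ℝ (Fin 3) → EuclideanSpace ℝ (Fin 3))
        (p : ℝ → EuclideanSpace ℝ (Fin 3) → ℝ),
        Literature.Analysis.FluidPDE.IsClassicalNSSolutionOn (Set.Ico 0 T) 1 0 u p →
        Literature.Analysis.FluidPDE.IsLerayHopfOn T 1 0 (u 0) u →
        Literature.Analysis.FluidPDE.HasRapidSpatialDecay (u 0) →
        ∀ x₀ : EuclideanSpace ℝ (Fin 3),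
          (∀ r₀ : ℝ, 0 < r₀ → ∃ r ∈ Set.Ioo 0 r₀,
            Literature.Analysis.FluidPDE.cknC r ((T, x₀) : ℝ × EuclideanSpace ℝ (Fin 3)) u ≤ ENNReal.ofReal M) →
          ∃ M' : ℝ, ∃ r₁ : ℝ, 0 < r₁ ∧ ∀ r ∈ Set.Ioo 0 r₁,
            Literature.Analysis.FluidPDE.cknC r ((T, x₀) : ℝ × EuclideanSpace ℝ (Fin 3)) u ≤ ENNReal.ofReal M')
    (hno : ¬ Literature.Analysis.FluidPDE.TypeISingularityExists) :
    Theses.SelfMixingDichotomy.SequentialTypeIExclusion := by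
  have hloc := stub_lerayHopfLocalEnergySolution
  have hcont := stub_continuationPastFinalTime
  have hpt := stub_finalTimeTypeISingularPoint
  intro M T hT u p hcl hLH hdec x₀ hlim
  obtain ⟨M', r₁, hr₁, hTI⟩ := hwin M T hT u p hcl hLH hdec x₀ hlim
  by_contra hB
  have hv := hloc T hT u p hcl hLH
  have hmem : MeasureTheory.MemLp (u T) 2 MeasureTheory.volume := hLH.memLp T ⟨hT.le, le_rfl⟩
  obtain ⟨U, P, hU, hagree⟩ := hcont T hT (u 0) u _ hv hmem
  have hsing := hpt M' T (T + 1) hT (by linarith) u p U P hcl hLH hU hagree x₀ ⟨r₁, hr₁, hTI⟩ hB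
  exact hno ⟨_, U, P, _, hsing⟩

/-- **The Type-I half alone, closed (no `sorry`): under `¬TypeISingularityExists`, a centred cubic Type-I bound at a
point of the final slice of a classical Leray–Hopf solution forces boundedness there** — i.e. centred Type-I
exclusion AT THE FINAL TIME for the crux's class follows from the registered interior conjecture (continuation past
`T`, p156995/p156682, + packaging, p157669). This is the sup-form of the crux. -/
theorem bdd_of_centredTypeIBound_of_not_typeISingularityExists
    (hno : ¬ Literature.Analysis.FluidPDE.TypeISingularityExists) :
    ∀ M' : ℝ, ∀ T : ℝ, 0 < T →
      ∀ (u : ℝ → EuclideanSpace ℝ (Fin 3) → EuclideanSpace ℝ (Fin 3))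
        (p : ℝ → EuclideanSpace ℝ (Fin 3) → ℝ),
        Literature.Analysis.FluidPDE.IsClassicalNSSolutionOn (Set.Ico 0 T) 1 0 u p →
        Literature.Analysis.FluidPDE.IsLerayHopfOn T 1 0 (u 0) u →
        ∀ x₀ : EuclideanSpace ℝ (Fin 3),
          (∃ r₁ : ℝ, 0 < r₁ ∧ ∀ r ∈ Set.Ioo 0 r₁,
            Literature.Analysis.FluidPDE.cknC r ((T, x₀) : ℝ × EuclideanSpace ℝ (Fin 3)) u ≤ ENNReal.ofReal M') →
          ∃ ρ : ℝ, 0 < ρ ∧ ∃ M : ℝ, ∀ t ∈ Set.Ioo (T - ρ ^ 2) T, ∀ x ∈ Metric.ball x₀ ρ, ‖u t x‖ ≤ M := by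
  intro M' T hT u p hcl hLH x₀ hTI
  by_contra hB
  have hv := stub_lerayHopfLocalEnergySolution T hT u p hcl hLH
  have hmem : MeasureTheory.MemLp (u T) 2 MeasureTheory.volume := hLH.memLp T ⟨hT.le, le_rfl⟩
  obtain ⟨U, P, hU, hagree⟩ := stub_continuationPastFinalTime T hT (u 0) u _ hv hmem
  have hsing := stub_finalTimeTypeISingularPoint M' T (T + 1) hT (by linarith) u p U P hcl hLH hU hagree x₀ hTI hB
  exact hno ⟨_, U, P, _, hsing⟩

end Summit.NavierStokesRegularity.NavierStokesRegularity.Cruxes.SequentialTypeIExclusion.BirthClosed
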